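import Summits.QuantumAdvantage.QuantumAdvantage.Theorems.CubicForrelationNearExactIsExactSixChecker

/-!
# Crux `CubicForrelation.NearExactIsExact` (stmt-QuantumAdvantage-14043) — the census at `n = 6` (`θ₆ = 25/32`),
  part 3/4: classes of cubic functions and the certificate

Certificate seat `b2b-cforr-cert` (gen 10).  HONEST FRAMING: a verified certificate FORMAT for a decidable verdict about
the finite slice `n = 6` — NOT summit progress.

This is the class layer of `Negative/SmallCases*.lean` (certified-compute seat, 2026-08-16) re-targeted from the
isolation property `Φ > 7/8 ⇒ Φ = 1` to the THRESHOLD property `cl_OKle θ g : ∀ cubic f, Φ(f,g) = 1 ∨ Φ(f,g) ≤ θ`: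
transport along invertible linear substitutions (`cl_okle_of_comp`) and affine strips (`cl_okle_affine`), classes by
cubic part (`cl_Qc`, `cl_qc_transport`), the per-representative computation (`cl_checkRep`, sound by
`cl_qc_of_checkRep` via part 2), the closure check (`cl_qc_all`, re-using the tree's untrusted BFS `bfs` and trusted
`verify`), and the certificate `cl_certify m THR reps gens inv` with its soundness `cl_certify_sound`:
for `n = m + m`, `1 ≤ m ≤ 4`, `THR ≥ (3/4)·2^{3m}`, every pair of cubic functions on `n` bits has
`Φ = 1 ∨ Φ ≤ THR/2^{3m}`.

References: C. Carlet, *Boolean Functions for Cryptography and Coding Theory* (CUP 2021) §2.2.1; X.-D. Hou,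
*GL(m,2) acting on R(r,m)/R(r−1,m)*, Discrete Math. 149 (1996); S. Aaronson, A. Ambainis, *Forrelation*, SIAM J.
Comput. 47 (2018) §1.1.1.  Everything below is proved from the tree; axioms are the standard three.
-/

set_option linter.dupNamespace false -- D-0017: single-problem summit ⇒ `QuantumAdvantage.QuantumAdvantage` by design

namespace Summit.QuantumAdvantage.QuantumAdvantage.Theorems.CubicForrelation.NearExactIsExact

open Finset
open Literature.Computability.QuantumComplexity
open Literature.Computability.QuantumComplexity.BuzetChailloux (bxor)
open Summit.QuantumAdvantage.QuantumAdvantage.Theorems.NearExactIsExact.Negative.SmallCases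

variable {n : ℕ}

/-! ### The threshold property of a fixed `g` and its transports -/

/-- `cl_OKle θ g`: every cubic partner `f` has `Φ(f,g) = 1` or `Φ(f,g) ≤ θ` (the threshold analogue of `OK78`).
[this work] -/
def cl_OKle (θ : ℝ) (g : (Fin n → Bool) → Bool) : Prop :=
  ∀ f : (Fin n → Bool) → Bool, IsDegLeFun 3 f → forrelation f g = 1 ∨ forrelation f g ≤ θ

/-- **Transport back along a generator**: `cl_OKle θ (g ∘ B) → cl_OKle θ g`. [folklore] -/
theorem cl_okle_of_comp {θ : ℝ} {G : GenRows} (hG : G.Good n) {g : (Fin n → Bool) → Bool}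
    (h : cl_OKle θ (fun x => g (lapp n G.B x))) : cl_OKle θ g := by
  obtain ⟨h1, h2, h3, h4, h5⟩ := hG
  intro f hf
  have e : forrelation f g = forrelation (fun x => f (lapp n G.Btinv x)) (fun x => g (lapp n G.B x)) := by
    have := forrelation_lin f (fun x => g (lapp n G.B x)) (lapp n G.Binv) (lapp n G.B) (lapp n G.Bt) (lapp n G.Btinv)
      h2 h1 h3 h4 h5
    simpa [h1] using this
  rw [e]
  exact h _ (isDegLeFun_lapp hf _)

/-- **Affine strip**: `cl_OKle θ g → cl_OKle θ (b ⊕ ℓ ⊕ g)` for a character `ℓ` and a constant `b` (the constant is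
moved onto the partner, `Φ(f, g ⊕ 1) = Φ(f ⊕ 1, g)`). [folklore] -/
theorem cl_okle_affine {θ : ℝ} {g ℓ : (Fin n → Bool) → Bool} (hg : cl_OKle θ g) (v : Fin n → Bool)
    (hℓ : ∀ y, signOf (ℓ y) = twist v y) (b : Bool) : cl_OKle θ (fun y => xor (xor b (ℓ y)) (g y)) := by
  intro f hf
  rw [forrelation_affine f g ℓ v hℓ b]
  have hsh : IsDegLeFun 3 (fun x => f (bxor x v)) := isDegLeFun_shift hf v
  cases b
  · simp only [signOf, Bool.false_eq_true, if_false, one_mul]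
    exact hg _ hsh
  · simp only [signOf, if_true, neg_mul, one_mul]
    have hc : IsDegLeFun 3 (fun x => !f (bxor x v)) := isDegLeFun_bnot hsh
    have e := forrelation_bnot_left (fun x => f (bxor x v)) g
    rcases hg _ hc with h1 | h1
    · left; rw [e] at h1; exact h1
    · right; rw [e] at h1; exact h1

/-- **`cl_OKle` passes from `gfun c q 0 false` to `gfun c q a b`.** [folklore] -/
theorem cl_okle_gfun_affine {θ : ℝ} {c q : ℕ} (h : cl_OKle θ (gfun n c q 0 false)) (a : ℕ) (b : Bool) :
    cl_OKle θ (gfun n c q a b) := by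
  have key := cl_okle_affine h (pt n a) (fun y => signOf_linear a y) b
  have e : (fun y => xor (xor b (ixval n (singles n) 0 a y)) (gfun n c q 0 false y)) = gfun n c q a b := by
    funext y
    unfold gfun
    rw [ixval_zero]
    generalize ixval n (singles n) 0 a y = A
    generalize ixval n (pairs n) 0 q y = B
    generalize ixval n (trips n) 0 c y = C
    cases b <;> cases A <;> cases B <;> cases C <;> rfl
  rw [e] at key
  exact key

/-! ### Classes by cubic part -/

/-- The class statement: every cubic `g` with cubic part `c` has the threshold property (the analogue of `Qc`).
[this work] -/
def cl_Qc (θ : ℝ) (n c : ℕ) : Prop := ∀ g : (Fin n → Bool) → Bool, IsDegLeFun 3 g → InClass n c g → cl_OKle θ g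

/-- **Transport of the class statement**: `cl_Qc θ (c·B) → cl_Qc θ c`. [folklore] -/
theorem cl_qc_transport {θ : ℝ} {G : GenRows} (hG : G.Good n) {tab : List Entry} (hT : TabOK n G.B tab) {c : ℕ}
    (h : cl_Qc θ n (cactL tab 0 c)) : cl_Qc θ n c :=
  fun _ hg hcl => cl_okle_of_comp hG (h _ (isDegLeFun_lapp hg G.B) (inClass_comp hT hcl))

/-- All quadratic masks for one cubic representative pass the per-function test of part 2. -/
def cl_checkRep (m THR : ℕ) (cols : Array ℕ) (ptab : Array (List (List ℕ))) (c : ℕ) : Bool :=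
  let n := m + m
  let tc := tabC n c
  let mt := monoTabs n
  (List.range (2 ^ (pairs n).length)).all fun q => ck_checkS m THR cols ptab (tabV n tc mt q)

/-- **Soundness of the per-representative computation**: `cl_checkRep` gives `cl_Qc (THR/2^{3m}) c`. [folklore] -/
theorem cl_qc_of_checkRep (m THR : ℕ) (hm1 : 1 ≤ m) (hm4 : m ≤ 4) (hθ : (3 / 4 : ℝ) ≤ (THR : ℝ) / (2 : ℝ) ^ (3 * m))
    {cols : Array ℕ} (hcols : ∀ k, k < 2 ^ (m + m) → ck_aget cols k = sy_col (m + m) k)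
    {ptab : Array (List (List ℕ))}
    (hptab : ∀ L ∈ ck_smallLists (2 ^ (m + m)), L ∈ ck_pget ptab (sy_xorCols (ck_aget cols) L))
    (c : ℕ) (h : cl_checkRep m THR cols ptab c = true) : cl_Qc ((THR : ℝ) / (2 : ℝ) ^ (3 * m)) (m + m) c := by
  intro g hg hcl
  obtain ⟨q, a, b, hq, rfl⟩ := exists_gfun_of_inClass hcl
  refine cl_okle_gfun_affine ?_ a b
  simp only [cl_checkRep, List.all_eq_true, List.mem_range] at h
  have hc := h q hq
  rw [tabV_eq] at hc
  intro f hf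
  have hpos : (0 : ℝ) < (2 : ℝ) ^ (3 * m) := by positivity
  rcases ck_checkS_sound m THR hm1 hm4 hcols hptab (gfun (m + m) c q 0 false) (isDegLeFun_gfun _ _ _ _) hc f hf
    with h1 | h1 | h1
  · exact Or.inl h1
  · exact Or.inr (h1.trans hθ)
  · right; rw [le_div_iff₀ hpos]; exact h1

/-- **Soundness of the closure check** for the threshold property: induction on the recorded distance. [folklore] -/
theorem cl_qc_all {θ : ℝ} {T : ℕ} {reps : List ℕ} {tabs : List (List Entry)} {dist par pg : Array ℕ}
    (hv : verify T reps tabs dist par pg = true) (hreps : ∀ c ∈ reps, cl_Qc θ n c)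
    (htr : ∀ i, i < tabs.length → ∀ c, cl_Qc θ n (cactL (tabs.getD i []) 0 c) → cl_Qc θ n c) :
    ∀ c, c < 2 ^ T → cl_Qc θ n c := by
  simp only [verify, List.all_eq_true, List.mem_range, Bool.or_eq_true, Bool.and_eq_true, decide_eq_true_eq,
    beq_iff_eq] at hv
  suffices H : ∀ d c, c < 2 ^ T → dist[c]! = d → cl_Qc θ n c from fun c hc => H _ c hc rfl
  intro d
  induction d using Nat.strong_induction_on with
  | _ d ih =>
    intro c hc hd
    rcases hv c hc with hr | ⟨⟨⟨hi, hact⟩, hp⟩, hlt⟩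
    · exact hreps c (List.contains_iff_mem.1 hr)
    · have hq : cl_Qc θ n (par[c]!) := ih _ (hd ▸ hlt) _ hp rfl
      rw [← hact] at hq
      exact htr _ hi c hq

/-! ### The certificate and its soundness -/

/-- **The certificate** for `n = m + m` at threshold `THR`: correct column table, complete pair table, representatives
pass the per-function tests, generators are good, substitution tables are correct, and the closure check passes on the
BFS output. -/
def cl_certify (m THR : ℕ) (reps : List ℕ) (gens : List GenRows) (inv : List ℕ) : Bool :=
  let n := m + m
  let T := (trips n).length
  let cols := ck_cols n
  let ptab := ck_mkPtab (sy_mons2 n).length cols (2 ^ n)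
  let tabs := gens.map fun G => mkTab n G.B
  let out := bfs T reps tabs inv
  ck_colsOK n cols && ck_ptabOK cols (2 ^ n) ptab && reps.all (cl_checkRep m THR cols ptab) &&
    gens.all (fun G => decide (G.Good n) && decide (TabOK n G.B (mkTab n G.B))) &&
      verify T reps tabs out.1 out.2.1 out.2.2

/-- **Soundness of the certificate**: for `1 ≤ m ≤ 4` and `THR ≥ (3/4)·2^{3m}`, every pair of cubic functions on
`m + m` bits has `Φ = 1` or `Φ ≤ THR/2^{3m}`. [this work] -/
theorem cl_certify_sound (m THR : ℕ) (hm1 : 1 ≤ m) (hm4 : m ≤ 4) (hθ : (3 / 4 : ℝ) ≤ (THR : ℝ) / (2 : ℝ) ^ (3 * m))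
    (reps : List ℕ) (gens : List GenRows) (inv : List ℕ) (h : cl_certify m THR reps gens inv = true) :
    ∀ f g : (Fin (m + m) → Bool) → Bool, IsDegLeFun 3 f → IsDegLeFun 3 g →
      forrelation f g = 1 ∨ forrelation f g ≤ (THR : ℝ) / (2 : ℝ) ^ (3 * m) := by
  intro f g hf hg
  simp only [cl_certify, Bool.and_eq_true, List.all_eq_true, decide_eq_true_eq] at h
  obtain ⟨⟨⟨⟨hcolsOK, hptabOK⟩, hreps⟩, hgens⟩, hv⟩ := h
  have hcols := ck_colsOK_spec hcolsOK
  have hptab := ck_ptabOK_spec hptabOK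
  have hall : ∀ c, c < 2 ^ (trips (m + m)).length → cl_Qc ((THR : ℝ) / (2 : ℝ) ^ (3 * m)) (m + m) c := by
    refine cl_qc_all hv (fun c hc => cl_qc_of_checkRep m THR hm1 hm4 hθ hcols hptab c (hreps c hc))
      (fun i hi c hq => ?_)
    have hi' : i < gens.length := by simpa using hi
    have hG := hgens (gens[i]) (List.getElem_mem hi')
    have e : (gens.map fun G => mkTab (m + m) G.B).getD i [] = mkTab (m + m) (gens[i]).B := by
      rw [List.getD_eq_getElem?_getD, List.getElem?_map, List.getElem?_eq_getElem hi']
      rfl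
    rw [e] at hq
    exact cl_qc_transport hG.1 hG.2 hq
  set P := mco (m + m) g with hP
  have hrep : g = gfun (m + m) (maskOf P (trips (m + m))) (maskOf P (pairs (m + m))) (maskOf P (singles (m + m)))
      (P []) := gfun_of_cubic g hg
  have hcl : InClass (m + m) (maskOf P (trips (m + m))) g := by
    rw [hrep]; exact inClass_gfun _ _ _ _
  exact hall _ (maskOf_lt P _) g hg hcl f hf

end Summit.QuantumAdvantage.QuantumAdvantage.Theorems.CubicForrelation.NearExactIsExact
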